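import Mathlib
import Summits.CriticalPhenomena.CardyFormulaZ2.Theorems.CardyMagicRigidityPositiveConeDefs
import Summits.CriticalPhenomena.CardyFormulaZ2.Theorems.CardyMagicRigidityNestingRigidityCloudAdmissibility
import Summits.CriticalPhenomena.CardyFormulaZ2.Theorems.CardyMagicRigidityNestingRigidityCloudEnergy
import Summits.CriticalPhenomena.CardyFormulaZ2.Theorems.CardyMagicRigidityNestingRigidityFusionBaseCases
import Literature.Probability.Percolation.NestingPhaseEstimates
import HarnessLib

/-!
# The cone lever: Gaussian side, factorisation, and the reduction of `stub_coneScaling` to one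
# loop-side estimate (line `positive-cone-weight-doubling`, crux `NestingRigidity`)

Crux `Summit.CriticalPhenomena.CardyFormulaZ2.Theses.CardyMagicRigidity.NestingRigidity`
(stmt-CriticalPhenomena-4835), line `positive-cone-weight-doubling`, registered stub
`stub_coneScaling : MagicFormulaZ2 → ConeTiltLaw zEns` (vocabulary
`Theorems/CardyMagicRigidityPositiveConeDefs.lean`, p96037, over the ring-cloud vocabulary
`Theorems/CardyMagicRigidityDefs.lean`).  THE LEVER feeds `MagicFormulaZ2` with the neutral density
`f_{t,r} = t(ρ_{B(0,r)} − σ_A)`, `A = {1 ≤ |z| < 2}`.  This file lands the parts of the stub that are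
provable now and isolates what is not as ONE named estimate, equivalent to the stub's conclusion:

* §1 `coneCloud t r` — the admissible cloud `{disc (0, r, t), ring (0, 1, 2, −t)}` for `0 < r ≤ 1`
  (`coneCloud_admissible`), its density `t ρ_{B(0,r)} − t σ_{0,1,2}` (`coneCloud_density`) and its
  EXACT Gaussian exponent `t²(log r + C₀)`, `C₀ = coneConst = −1/4 − 2·ringHolePotential 1 2 +
  ringSelfEnergy 1 2` (`coneCloud_energy`: the disc sits in the ring's hole, where the ring potential
  is constant — the sibling line's `CloudEnergy`, p74556).
* §2 `coneScaling_gaussian` (registered sub-goal) — THE GAUSSIAN SIDE: under `MagicFormulaZ2`,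
  `Λ_δ(f_{t,r}) → exp((3/4π²) t²(log r + C₀)) = e^{βt²C₀} · r^{βt²}` as `δ → 0⁺`; more generally for
  every ensemble with the cloud law (`tendsto_nestingWeight_coneCloud_of_cloudLaw`), whence the
  Gaussian sandwich `K r^{βt²}/2 < E_δ[A_{f_{t,r}}] < 2K r^{βt²}` for small meshes
  (`eventually_gaussian_sandwich`).
* §3 THE FACTORISATION (deterministic): every TOWER loop (interior `⊇ B̄(0,r)`, trace `⊆ B(0,1)`)
  has phase exactly `t` (`nestingPhase_coneDensity_of_tower`: its interior lies in `B(0,1)`, where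
  `σ_A = 0`, and contains `B(0,r)`, which carries the unit mass of `ρ_{B(0,r)}`), hence weight
  `w(t) = magicWeight t`; so `A_f(c) = w(t)^{N_0(r,1)} · ∏_{non-tower loops} cos_μ(θ_u)` on every
  configuration with finitely many contributing loops (`nestingWeight_coneDensity_eq`), in
  particular on bond-`ℤ²` at every mesh `δ > 0` (`nestingWeight_zEns_coneDensity_eq`, registered
  sub-goal; finiteness from `ncard_loops_meeting_le` and `∫ f = 0`).
* §4 THE REDUCTION: for ANY ensemble `E` with the cloud law, the UV decoupling estimate
  `UVDecoupling E` (`r^{η} E_δ[w^N] e^{√3 t E_δ N} ≤ E_δ[A_{f_{t,r}}] ≤ r^{−η} E_δ[w^N] e^{√3 t E_δ N}`,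
  small `r`, then small `δ`) implies `ConeTiltLaw E` (`coneTiltLaw_of_cloudLaw`; conversely by the
  same sandwich); for bond-`ℤ²` the loop side of the stub is the FACTORISED estimate `ConeUVDecoupling`
  over `coneFunctional t r δ = E_δ[w(t)^{N_0(r,1)} ∏_{non-tower} cos_μ θ_u]` (`coneUVDecoupling_iff`),
  and `coneTiltLaw_of_coneUVDecoupling : MagicFormulaZ2 → ConeUVDecoupling → ConeTiltLaw zEns`
  (registered sub-goal): `stub_coneScaling` is exactly `ConeUVDecoupling` away — RSW
  quasi-multiplicativity of positively WEIGHTED tower functionals on `ℤ²`, absent from the tree.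

Sign check (UV drift on the SAME side as the tower moment, as in `ConeTiltLaw`): loops `u ⊂ B(0,r)`
weigh `2cos(π/3 + t b_u) ≈ 1 − √3 t b_u` (`b_u = |int u|/πr²`), loops `u ⊂ A` weigh `≈ 1 + √3 t b'_u`
(`b'_u = |int u|/3π`), and `E_δ[Σ_B b_u − Σ_A b'_u] = ν log(r/δ) − ν log(1/δ) + O(1) = −E_δ N + O(1)`,
so UV `≈ e^{+√3 t E_δ N}` and `E_δ[w(t)^N] e^{√3 t E_δ N} ≍ r^{βt²}`; with `E_δ N = ν log(1/r)`,
`√3 ν = 1/2π`, this is SSW's `E[w(t)^N] ≍ r^{βt² + t/2π}` (`calibrated_exponent_eq_magicExponent_six`).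
Nothing is asserted: `UVDecoupling E` / `ConeUVDecoupling` are `def … : Prop`s used as hypotheses.
-/

noncomputable section

open MeasureTheory Set Filter Metric
open scoped Real Topology BigOperators ENNReal

namespace Summit.CriticalPhenomena.CardyFormulaZ2.Cruxes.NestingRigidity.PositiveConeWeightDoubling

open Literature.Probability.RandomPlanarGeometry Literature.Probability.Percolation
  Literature.Probability.LatticeModels
open Summit.CriticalPhenomena.CardyFormulaZ2.Theses.CardyMagicRigidity
open Summit.CriticalPhenomena.CardyFormulaZ2.Cruxes.NestingRigidity.RingCloudTomography

/-! ## §1 The cone cloud -/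

/-- THE CONE CLOUD of the lever: one disc bump (centre `0`, radius `r`, charge `t`) and one ring
(centre `0`, radii `1 < 2`, charge `−t`); its density is `t(ρ_{B(0,r)} − σ_A)`, `A = {1 ≤ |z| < 2}`
(`σ_A = annulusDensity 0 1 2`). -/
def coneCloud (t r : ℝ) : Cloud where
  m := 1
  n := 1
  x := fun _ ↦ 0
  r := fun _ ↦ r
  a := fun _ ↦ t
  c := fun _ ↦ 0
  L := fun _ ↦ 1
  M := fun _ ↦ 2
  g := fun _ ↦ -t

/-- The constant `C₀` of the cone energy `t²(log r + C₀)`: disc self-energy constant `−1/4`, twice the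
(negated) ring-hole cross term and the ring self-energy of the ring `1 ≤ |z| < 2`. -/
def coneConst : ℝ := -1 / 4 - 2 * ringHolePotential 1 2 + ringSelfEnergy 1 2

/-- The cone cloud is admissible for `0 < r ≤ 1` (the disc sits in the ring's hole). -/
theorem coneCloud_admissible {t r : ℝ} (hr : 0 < r) (hr1 : r ≤ 1) : (coneCloud t r).Admissible where
  r_pos := fun _ ↦ hr
  L_pos := fun _ ↦ one_pos
  L_lt_M := fun _ ↦ show (1 : ℝ) < 2 by norm_num
  neutral := by simp [coneCloud]
  disc_disc := fun i j hij ↦ absurd (Subsingleton.elim (α := Fin 1) i j) hij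
  disc_ring := fun _ _ ↦ Or.inl (show ‖(0 : ℂ) - 0‖ + r ≤ 1 by simpa using hr1)
  ring_ring := fun k l hkl ↦ absurd (Subsingleton.elim (α := Fin 1) k l) hkl

/-- The density of the cone cloud is `t ρ_{B(0,r)} − t σ_{0,1,2}`. -/
theorem coneCloud_density (t r : ℝ) :
    (coneCloud t r).density = fun z ↦ t * discDensity 0 r z - t * annulusDensity 0 1 2 z := by
  funext z; simp [Cloud.density, coneCloud, sub_eq_add_neg]

/-- The Gaussian exponent of the cone cloud is EXACTLY `t²(log r + C₀)` for `r ≤ 1`. -/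
theorem coneCloud_energy (t : ℝ) {r : ℝ} (hr1 : r ≤ 1) :
    (coneCloud t r).energy = t ^ 2 * (Real.log r + coneConst) := by
  simp [Cloud.energy, coneCloud, coneConst, discSelfEnergy, hr1]; ring

/-! ## §2 The Gaussian side of the lever -/

/-- `MagicFormulaZ2` (definitionally the magic transform of `zEns`) gives the cloud law of `zEns`
(cloud calculus S1 of the sibling line: instantiate at the cloud density, substitute the energy). -/
theorem cloudLaw_zEns_of (hZ : MagicFormulaZ2) : zEns.CloudLaw := by
  intro 𝔠 h𝔠
  obtain ⟨hm, ⟨C, hC⟩, ⟨R, hR⟩, h0, hQ⟩ :=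
    cloudCalculus_of stub_cloudAdmissibility stub_cloudEnergy 𝔠 h𝔠
  rw [← hQ]
  exact hZ _ R C hm hC hR h0

/-- **The Gaussian side of the cone lever** (registered sub-goal). Under `MagicFormulaZ2`, for
`0 < r ≤ 1` the nesting transform of bond-`ℤ²` at the cone density converges, as `δ → 0⁺`, to
`exp((3/4π²) · t²(log r + C₀))`. -/
theorem coneScaling_gaussian : MagicFormulaZ2 → ∀ (t r : ℝ), 0 < r → r ≤ 1 →
    Tendsto (fun δ : ℝ ↦ ∫ ω, (zEns.X δ ω).nestingWeight (coneCloud t r).density ∂zEns.P) (𝓝[>] 0)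
      (𝓝 (Real.exp (3 / (4 * π ^ 2) * (t ^ 2 * (Real.log r + coneConst))))) := by
  intro hZ t r hr hr1
  rw [← coneCloud_energy t hr1]
  exact cloudLaw_zEns_of hZ _ (coneCloud_admissible hr hr1)

/-- The Gaussian limit in power form: `exp(β t²(log r + C₀)) = exp(β t² C₀) · r^{β t²}`. -/
theorem exp_coneEnergy_eq_rpow (t : ℝ) {r : ℝ} (hr : 0 < r) :
    Real.exp (3 / (4 * π ^ 2) * (t ^ 2 * (Real.log r + coneConst))) =
      Real.exp (beta * t ^ 2 * coneConst) * r ^ (beta * t ^ 2) := by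
  rw [Real.rpow_def_of_pos hr, ← Real.exp_add, beta]
  ring_nf

/-- **The Gaussian side for ANY ensemble with the cloud law** (`LoopEnsemble.CloudLaw`; `zEns` under
`MagicFormulaZ2` by `cloudLaw_zEns_of`, `tEns` likewise under `MagicFormulaT`), power form:
`E_δ[A_{f_{t,r}}] → exp(β t² C₀) · r^{β t²}`. -/
theorem tendsto_nestingWeight_coneCloud_of_cloudLaw {E : LoopEnsemble} (hE : E.CloudLaw) (t r : ℝ)
    (hr : 0 < r) (hr1 : r ≤ 1) :
    Tendsto (fun δ : ℝ ↦ ∫ ω, (E.X δ ω).nestingWeight (coneCloud t r).density ∂E.P) (𝓝[>] 0)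
      (𝓝 (Real.exp (beta * t ^ 2 * coneConst) * r ^ (beta * t ^ 2))) := by
  rw [← exp_coneEnergy_eq_rpow t hr, ← coneCloud_energy t hr1]
  exact hE _ (coneCloud_admissible hr hr1)

/-- **The Gaussian sandwich**: with `K = e^{βt²C₀}`, for all small meshes
`K r^{βt²}/2 < E_δ[A_{f_{t,r}}] < 2K r^{βt²}`. -/
theorem eventually_gaussian_sandwich {E : LoopEnsemble} (hE : E.CloudLaw) (t : ℝ) {r : ℝ}
    (hr : 0 < r) (hr1 : r ≤ 1) :
    ∀ᶠ δ in 𝓝[>] (0 : ℝ),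
      Real.exp (beta * t ^ 2 * coneConst) * r ^ (beta * t ^ 2) / 2 <
          ∫ ω, (E.X δ ω).nestingWeight (coneCloud t r).density ∂E.P ∧
        ∫ ω, (E.X δ ω).nestingWeight (coneCloud t r).density ∂E.P <
          2 * (Real.exp (beta * t ^ 2 * coneConst) * r ^ (beta * t ^ 2)) := by
  have hG := tendsto_nestingWeight_coneCloud_of_cloudLaw hE t r hr hr1
  have hL : 0 < Real.exp (beta * t ^ 2 * coneConst) * r ^ (beta * t ^ 2) :=
    mul_pos (Real.exp_pos _) (Real.rpow_pos_of_pos hr _)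
  exact ((tendsto_order.1 hG).1 _ (by linarith)).and ((tendsto_order.1 hG).2 _ (by linarith))

/-! ## §3 The factorisation of the loop functional at the cone density -/

/-- The TOWER SET above `0` of a configuration: its loops with trace in the unit window `B(0,1)`
whose winding interior contains `B̄(0,r)` (`towerCount c 0 r 1` is literally its `ncard`). -/
def towerSet (c : LoopConfig ℂ) (r : ℝ) : Set (UnbasedLoop ℂ) :=
  {u ∈ c.loops | closedBall (0 : ℂ) r ⊆ {z | u.wind z ≠ 0} ∧ u.range ⊆ ball (0 : ℂ) 1}

/-- `towerCount c 0 r 1 = #(towerSet c r)` (definitional). -/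
theorem towerCount_eq_ncard_towerSet (c : LoopConfig ℂ) (r : ℝ) : towerCount c 0 r 1 = (towerSet c r).ncard :=
  rfl

/-- **(c1) Tower loops carry the full charge.** A loop whose interior contains `B̄(0,r)` and whose
trace lies in `B(0,1)` has phase `∫_{int u} t(ρ_{B(0,r)} − σ_{0,1,2}) = t`: its interior lies in
`B(0,1)` (a loop inside a ball does not wind around points outside it), where the ring density
vanishes, and contains the disc `B(0,r)` carrying the unit mass of `ρ_{B(0,r)}`. -/
theorem nestingPhase_coneDensity_of_tower {t r : ℝ} (hr : 0 < r) {u : UnbasedLoop ℂ}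
    (hwind : closedBall (0 : ℂ) r ⊆ {z | u.wind z ≠ 0}) (hrange : u.range ⊆ ball (0 : ℂ) 1) :
    u.nestingPhase (coneCloud t r).density = t := by
  rw [UnbasedLoop.nestingPhase, coneCloud_density]
  have h1 : ∫ z in {z | u.wind z ≠ 0}, discDensity 0 r z = 1 := by
    rw [setIntegral_eq_integral_of_forall_compl_eq_zero fun z hz ↦ ?_,
      CloudAdmissibility.integral_discDensity _ hr]
    refine CloudAdmissibility.discDensity_eq_zero (not_lt.1 fun hzr ↦ hz (hwind ?_))
    rw [sub_zero] at hzr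
    exact mem_closedBall.2 (by rw [dist_zero_right]; exact hzr.le)
  have h2 : ∫ z in {z | u.wind z ≠ 0}, annulusDensity 0 1 2 z = 0 := by
    refine setIntegral_eq_zero_of_forall_eq_zero fun z hz ↦ ?_
    have hz1 : ‖z‖ < 1 := not_le.1 fun h1z ↦
      hz (unbasedLoop_wind_eq_zero_of_subset_ball u hrange (by rwa [dist_zero_right]))
    unfold annulusDensity
    exact Set.indicator_of_notMem (fun h ↦ (not_le.2 hz1) (by simpa using h.1)) _
  rw [integral_sub ((CloudAdmissibility.integrable_discDensity 0 r).const_mul t).integrableOn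
      ((CloudAdmissibility.integrable_annulusDensity 0 1 2).const_mul t).integrableOn,
    integral_const_mul, integral_const_mul, h1, h2, mul_one, mul_zero, sub_zero]

/-- **(c1') Tower loops weigh `w(t)`**: `nestingFactor = 2cos(t + π/3) = magicWeight t`. -/
theorem nestingFactor_coneDensity_of_tower {t r : ℝ} (hr : 0 < r) {u : UnbasedLoop ℂ}
    (hwind : closedBall (0 : ℂ) r ⊆ {z | u.wind z ≠ 0}) (hrange : u.range ⊆ ball (0 : ℂ) 1) :
    u.nestingFactor (coneCloud t r).density = magicWeight t := by
  rw [UnbasedLoop.nestingFactor, nestingPhase_coneDensity_of_tower hr hwind hrange, magicWeight]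

/-- The `finprod` of a constant over a set is the constant to the power `ncard` (both sides are the
junk `1 = w ^ 0` on an infinite set). -/
theorem finprod_mem_const_eq_pow {α M : Type*} [CommMonoid M] (s : Set α) (w : M) :
    ∏ᶠ _x ∈ s, w = w ^ s.ncard := by
  rcases s.finite_or_infinite with hs | hs
  · rw [finprod_mem_eq_finite_toFinset_prod _ hs, Finset.prod_const, Set.ncard_eq_toFinset_card s hs]
  · rw [hs.ncard, pow_zero]
    by_cases hw : w = 1
    · exact finprod_mem_eq_one_of_forall_eq_one fun _ _ ↦ hw
    · apply finprod_mem_eq_one_of_infinite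
      rwa [Function.mulSupport_const hw, Set.inter_univ]

/-- **(c2) The factorisation.** On a configuration with finitely many contributing loops (weight
`≠ 1`; every lattice configuration at positive mesh qualifies, `finite_loops_inter_mulSupport_zEns`),
the loop functional at the cone density splits as the TOWER FACTOR `w(t)^{N_0(r,1)}` times the
product of the weights of the non-tower loops. -/
theorem nestingWeight_coneDensity_eq (c : LoopConfig ℂ) {t r : ℝ} (hr : 0 < r)
    (hfin : (c.loops ∩ Function.mulSupport fun u ↦ u.nestingFactor (coneCloud t r).density).Finite) :
    c.nestingWeight (coneCloud t r).density =
      magicWeight t ^ towerCount c 0 r 1 *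
        ∏ᶠ u ∈ c.loops \ towerSet c r, u.nestingFactor (coneCloud t r).density := by
  rw [LoopConfig.nestingWeight,
    ← finprod_mem_mul_sdiff' (fun _ hu ↦ hu.1 : towerSet c r ⊆ c.loops) hfin,
    towerCount_eq_ncard_towerSet, ← finprod_mem_const_eq_pow]
  congr 1
  exact finprod_mem_congr rfl fun u hu ↦ nestingFactor_coneDensity_of_tower hr hu.2.1 hu.2.2

/-- On bond-`ℤ²` at mesh `δ > 0` only finitely many loops have weight `≠ 1` at the cone density:
contributing loops meet the closed ball carrying the density (`∫ f = 0`, `f = 0` off the ball: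
`range_inter_closedBall_nonempty_of_nestingFactor_ne_one`), and finitely many interface loops of
`δℤ²` meet a ball (`ncard_loops_meeting_le`). -/
theorem finite_loops_inter_mulSupport_zEns {δ : ℝ} (hδ : 0 < δ) (ω : BondConfig (Site 2)) {t r : ℝ}
    (hr : 0 < r) (hr1 : r ≤ 1) :
    ((zEns.X δ ω).loops ∩
      Function.mulSupport fun u ↦ u.nestingFactor (coneCloud t r).density).Finite := by
  obtain ⟨-, -, ⟨R, hR⟩, h0⟩ := stub_cloudAdmissibility (coneCloud t r) (coneCloud_admissible hr hr1)
  refine (ncard_loops_meeting_le hδ R ω).1.subset ?_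
  rintro u ⟨hu, hne⟩
  exact ⟨hu, range_inter_closedBall_nonempty_of_nestingFactor_ne_one hR h0 hne⟩

/-- **(c2, lattice form; registered sub-goal).** For every mesh `δ > 0`, every bond configuration `ω`
and `0 < r ≤ 1`: `A_f(X_δ(ω)) = w(t)^{N_0(r,1)} · ∏_{non-tower loops} 2cos(θ_u + π/3)` at the cone
density `f`. -/
theorem nestingWeight_zEns_coneDensity_eq : ∀ {δ : ℝ}, 0 < δ → ∀ (ω : BondConfig (Site 2)) {t r : ℝ},
    0 < r → r ≤ 1 →
    (zEns.X δ ω).nestingWeight (coneCloud t r).density =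
      magicWeight t ^ towerCount (zEns.X δ ω) 0 r 1 *
        ∏ᶠ u ∈ (zEns.X δ ω).loops \ towerSet (zEns.X δ ω) r,
          u.nestingFactor (coneCloud t r).density :=
  fun hδ ω _ _ hr hr1 ↦
    nestingWeight_coneDensity_eq _ hr (finite_loops_inter_mulSupport_zEns hδ ω hr hr1)

/-! ## §4 What remains: the loop side as ONE named estimate, and the reduction -/

/-- **The missing loop-side estimate, transform form, for an ensemble `E`** (UV decoupling of the
cone functional): in the positive cone `|t| < π/6`, for every `η > 0`, all small `r` and then all
small meshes, the nesting transform at the cone density equals the tilted tower moment times the UV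
drift `exp(√3 t · E_δ[N_0(r,1)])` of the SAME ensemble up to `r^{±η}`:
`r^{η} · E_δ[w^N] e^{√3 t E_δ N} ≤ E_δ[A_{f_{t,r}}] ≤ r^{−η} · E_δ[w^N] e^{√3 t E_δ N}`.
Given the cloud law it implies `ConeTiltLaw E` (`coneTiltLaw_of_cloudLaw`) and, by the same
sandwich, follows from it.  Content (absent from the tree, both lattices): RSW quasi-multiplicativity
of positively WEIGHTED tower functionals (all weights are `≥ 0` in the cone), concentration of the
UV drift `exp(−√3 t (Σ_B b_u − Σ_A b'_u))(1 + O(Σ b²))`, and the first-moment identity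
`E_δ[Σ_B b_u − Σ_A b'_u] = −E_δ[N_0(r,1)] + O(1)` (translation invariance; `δ` cancels). -/
def UVDecoupling (E : LoopEnsemble) : Prop :=
  ∀ t ∈ Set.Ioo (-(π / 6)) (π / 6), ∀ η : ℝ, 0 < η → ∃ r₀ : ℝ, 0 < r₀ ∧ ∀ r ∈ Set.Ioo (0 : ℝ) r₀,
    ∀ᶠ δ in 𝓝[>] (0 : ℝ),
      r ^ η * (E.towerMoment (magicWeight t) δ r * Real.exp (Real.sqrt 3 * t * meanTower E δ r)) ≤
          ∫ ω, (E.X δ ω).nestingWeight (coneCloud t r).density ∂E.P ∧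
        ∫ ω, (E.X δ ω).nestingWeight (coneCloud t r).density ∂E.P ≤
          r ^ (-η) * (E.towerMoment (magicWeight t) δ r * Real.exp (Real.sqrt 3 * t * meanTower E δ r))

/-- `r ↦ r^{s}` is small near `0⁺` for `s > 0`: for every `m > 0` there is `r₁ > 0` with `r^{s} < m`
on `(0, r₁)`. -/
theorem exists_rpow_lt {s m : ℝ} (hs : 0 < s) (hm : 0 < m) :
    ∃ r₁ : ℝ, 0 < r₁ ∧ ∀ r ∈ Set.Ioo (0 : ℝ) r₁, r ^ s < m := by
  have hc : Tendsto (fun r : ℝ ↦ r ^ s) (𝓝 0) (𝓝 0) := by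
    have := (Real.continuousAt_rpow_const 0 s (Or.inr hs.le)).tendsto
    rwa [Real.zero_rpow hs.ne'] at this
  have hev : ∀ᶠ r in 𝓝[>] (0 : ℝ), r ^ s < m :=
    (hc.mono_left nhdsWithin_le_nhds).eventually (gt_mem_nhds hm)
  obtain ⟨r₁, hr₁, hsub⟩ := mem_nhdsGT_iff_exists_Ioo_subset.1 hev
  exact ⟨r₁, hr₁, fun r hr ↦ hsub hr⟩

/-- **The reduction for a general ensemble**: the cloud law (Gaussian side at the cone cloud,
`E_δ[A_{f_{t,r}}] → K r^{βt²}`, `K = e^{βt²C₀}`) and the UV decoupling estimate imply the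
self-consistent cone law `ConeTiltLaw E`.  Proof: at `η/2`, sandwich `E_δ[A_{f_{t,r}}]` between
`K r^{βt²}/2` and `2K r^{βt²}` for small meshes and absorb `K/2`, `2K` into `r^{∓η/2}` for `r` small. -/
theorem coneTiltLaw_of_cloudLaw {E : LoopEnsemble} (hE : E.CloudLaw) (hUV : UVDecoupling E) :
    ConeTiltLaw E := by
  intro t ht η hη
  set K : ℝ := Real.exp (beta * t ^ 2 * coneConst) with hK
  have hK0 : 0 < K := Real.exp_pos _
  have hη2 : 0 < η / 2 := half_pos hη
  obtain ⟨r₀, hr₀, hdec⟩ := hUV t ht (η / 2) hη2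
  obtain ⟨r₁, hr₁, hsmall⟩ :=
    exists_rpow_lt hη2 (lt_min (half_pos hK0) (by positivity : 0 < 1 / (2 * K)))
  refine ⟨min (min r₀ r₁) 1, lt_min (lt_min hr₀ hr₁) one_pos, fun r hr ↦ ?_⟩
  have hr0 : 0 < r := hr.1
  have hrm : r ^ (η / 2) < min (K / 2) (1 / (2 * K)) :=
    hsmall r ⟨hr0, hr.2.trans_le ((min_le_left _ _).trans (min_le_right _ _))⟩
  have hr1 : r ≤ 1 := (hr.2.trans_le (min_le_right _ _)).le
  filter_upwards [hdec r ⟨hr0, hr.2.trans_le ((min_le_left _ _).trans (min_le_left _ _))⟩,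
    eventually_gaussian_sandwich hE t hr0 hr1] with δ hd hG
  obtain ⟨hd1, hd2⟩ := hd
  obtain ⟨hl, hu⟩ := hG
  have hρ : 0 < r ^ (η / 2) := Real.rpow_pos_of_pos hr0 _
  rw [Real.rpow_neg hr0.le] at hd2
  have e1 : r ^ (beta * t ^ 2 + η) = r ^ (beta * t ^ 2) * r ^ (η / 2) * r ^ (η / 2) := by
    rw [← Real.rpow_add hr0, ← Real.rpow_add hr0]; ring_nf
  have e2 : r ^ (beta * t ^ 2 - η) * (r ^ (η / 2) * r ^ (η / 2)) = r ^ (beta * t ^ 2) := by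
    rw [← Real.rpow_add hr0, ← Real.rpow_add hr0]; ring_nf
  constructor
  · have h1 : r ^ (η / 2) * ∫ ω, (E.X δ ω).nestingWeight (coneCloud t r).density ∂E.P ≤
        E.towerMoment (magicWeight t) δ r * Real.exp (Real.sqrt 3 * t * meanTower E δ r) :=
      (le_inv_mul_iff₀ hρ).1 hd2
    have h2 : r ^ (η / 2) ≤ K / 2 := hrm.le.trans (min_le_left _ _)
    calc r ^ (beta * t ^ 2 + η) = r ^ (beta * t ^ 2) * r ^ (η / 2) * r ^ (η / 2) := e1
      _ ≤ r ^ (beta * t ^ 2) * (K / 2) * r ^ (η / 2) := by gcongr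
      _ = r ^ (η / 2) * (K * r ^ (beta * t ^ 2) / 2) := by ring
      _ ≤ r ^ (η / 2) * ∫ ω, (E.X δ ω).nestingWeight (coneCloud t r).density ∂E.P := by gcongr
      _ ≤ _ := h1
  · have h1 : E.towerMoment (magicWeight t) δ r * Real.exp (Real.sqrt 3 * t * meanTower E δ r) ≤
        (r ^ (η / 2))⁻¹ * ∫ ω, (E.X δ ω).nestingWeight (coneCloud t r).density ∂E.P :=
      (le_inv_mul_iff₀ hρ).2 hd1
    have h2 : 2 * K ≤ (r ^ (η / 2))⁻¹ := by
      have h3 : r ^ (η / 2) ≤ 1 / (2 * K) := hrm.le.trans (min_le_right _ _)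
      rw [le_inv_comm₀ (by positivity) hρ, ← one_div]
      exact h3
    calc E.towerMoment (magicWeight t) δ r * Real.exp (Real.sqrt 3 * t * meanTower E δ r)
        ≤ (r ^ (η / 2))⁻¹ * ∫ ω, (E.X δ ω).nestingWeight (coneCloud t r).density ∂E.P := h1
      _ ≤ (r ^ (η / 2))⁻¹ * (2 * (K * r ^ (beta * t ^ 2))) := by gcongr
      _ = (r ^ (η / 2))⁻¹ * (2 * K) * r ^ (beta * t ^ 2) := by ring
      _ ≤ (r ^ (η / 2))⁻¹ * (r ^ (η / 2))⁻¹ * r ^ (beta * t ^ 2) := by gcongr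
      _ = r ^ (beta * t ^ 2 - η) := by rw [← e2]; field_simp

/-! ### Bond-`ℤ²`: the estimate over the FACTORISED functional, and `stub_coneScaling` modulo it -/

/-- The CONE FUNCTIONAL of bond-`ℤ²` in factorised form:
`E_δ[w(t)^{N_0(r,1)} · ∏_{non-tower loops} cos_μ(θ_u)]` (equal to the nesting transform
`Λ_δ(f_{t,r})` at every mesh `δ > 0`, `integral_nestingWeight_eq_coneFunctional`). -/
def coneFunctional (t r δ : ℝ) : ℝ :=
  ∫ ω, magicWeight t ^ towerCount (zEns.X δ ω) 0 r 1 *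
    ∏ᶠ u ∈ (zEns.X δ ω).loops \ towerSet (zEns.X δ ω) r,
      u.nestingFactor (coneCloud t r).density ∂zEns.P

/-- At positive mesh the nesting transform of bond-`ℤ²` at the cone density IS the cone functional. -/
theorem integral_nestingWeight_eq_coneFunctional {δ : ℝ} (hδ : 0 < δ) {t r : ℝ} (hr : 0 < r)
    (hr1 : r ≤ 1) :
    ∫ ω, (zEns.X δ ω).nestingWeight (coneCloud t r).density ∂zEns.P = coneFunctional t r δ :=
  integral_congr_ae (Eventually.of_forall fun ω ↦ nestingWeight_zEns_coneDensity_eq hδ ω hr hr1)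

/-- **The missing loop-side estimate for bond-`ℤ²`, factorised form** — what must be shown about
`E_δ[w(t)^{N_0(r,1)} · ∏_{non-tower} cos_μ θ_u]` versus `E_δ[w(t)^{N_0(r,1)}] · e^{√3 t E_δ[N_0(r,1)]}`
for `ConeTiltLaw zEns` to follow from the Gaussian side (§2) and the factorisation (§3): the product
of the NON-tower weights decouples from the tower factor and equals the UV drift of the same ensemble
up to `r^{±η}`, for all small `r` and then all small meshes, throughout the cone `|t| < π/6`.
Equivalent to the transform form `UVDecoupling zEns` (`coneUVDecoupling_iff`). -/
def ConeUVDecoupling : Prop :=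
  ∀ t ∈ Set.Ioo (-(π / 6)) (π / 6), ∀ η : ℝ, 0 < η → ∃ r₀ : ℝ, 0 < r₀ ∧ ∀ r ∈ Set.Ioo (0 : ℝ) r₀,
    ∀ᶠ δ in 𝓝[>] (0 : ℝ),
      r ^ η * (zEns.towerMoment (magicWeight t) δ r * Real.exp (Real.sqrt 3 * t * meanTower zEns δ r)) ≤
          coneFunctional t r δ ∧
        coneFunctional t r δ ≤
          r ^ (-η) *
            (zEns.towerMoment (magicWeight t) δ r * Real.exp (Real.sqrt 3 * t * meanTower zEns δ r))

/-- The factorised and the transform forms of the bond-`ℤ²` estimate are equivalent (by the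
factorisation at positive mesh, after shrinking `r₀` below `1`). -/
theorem coneUVDecoupling_iff : ConeUVDecoupling ↔ UVDecoupling zEns := by
  constructor
  · intro h t ht η hη
    obtain ⟨r₀, hr₀, h⟩ := h t ht η hη
    refine ⟨min r₀ 1, lt_min hr₀ one_pos, fun r hr ↦ ?_⟩
    have hr1 : r ≤ 1 := (hr.2.trans_le (min_le_right _ _)).le
    filter_upwards [h r ⟨hr.1, hr.2.trans_le (min_le_left _ _)⟩,
      (eventually_mem_nhdsWithin : ∀ᶠ δ in 𝓝[>] (0 : ℝ), δ ∈ Set.Ioi 0)] with δ hd hδ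
    rwa [integral_nestingWeight_eq_coneFunctional hδ hr.1 hr1]
  · intro h t ht η hη
    obtain ⟨r₀, hr₀, h⟩ := h t ht η hη
    refine ⟨min r₀ 1, lt_min hr₀ one_pos, fun r hr ↦ ?_⟩
    have hr1 : r ≤ 1 := (hr.2.trans_le (min_le_right _ _)).le
    filter_upwards [h r ⟨hr.1, hr.2.trans_le (min_le_left _ _)⟩,
      (eventually_mem_nhdsWithin : ∀ᶠ δ in 𝓝[>] (0 : ℝ), δ ∈ Set.Ioi 0)] with δ hd hδ
    rwa [← integral_nestingWeight_eq_coneFunctional hδ hr.1 hr1]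

/-- **The reduction for bond-`ℤ²`** (registered sub-goal): the Gaussian side of the lever
(`MagicFormulaZ2` ⇒ cloud law of `zEns` ⇒ `Λ_δ(f_{t,r}) → e^{βt²C₀} r^{βt²}`), the factorisation of the
loop functional (§3) and the loop-side estimate `ConeUVDecoupling` imply `ConeTiltLaw zEns`. -/
theorem coneTiltLaw_of_coneUVDecoupling : MagicFormulaZ2 → ConeUVDecoupling → ConeTiltLaw zEns :=
  fun hZ hUV ↦ coneTiltLaw_of_cloudLaw (cloudLaw_zEns_of hZ) (coneUVDecoupling_iff.1 hUV)

/-- Hence the registered stub `stub_coneScaling : MagicFormulaZ2 → ConeTiltLaw zEns` is EXACTLY the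
loop-side estimate `ConeUVDecoupling` away (recorded as an implication; nothing is asserted). -/
theorem coneScaling_of_coneUVDecoupling (hUV : ConeUVDecoupling) : ConeScaling :=
  fun hZ ↦ coneTiltLaw_of_coneUVDecoupling hZ hUV

end Summit.CriticalPhenomena.CardyFormulaZ2.Cruxes.NestingRigidity.PositiveConeWeightDoubling

end
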